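import Literature.Analysis.FluidPDE.Tao2016AveragedNS.GateFragility
import HarnessLib

/-!
# Tao 2016, §5.5 — trigger fragility: the kick channel of the delay circuit's clock

T. Tao, *Finite time blowup for an averaged three-dimensional Navier–Stokes equation*, J. Amer.
Math. Soc. **29** (2016) 601–674 = arXiv:1402.0290, §5.5 (the five-mode delay circuit (5.5) with
datum (5.6); Theorem 5.3, the "delayed abrupt energy transition" `a → ã` at `t_c ≈ √2`; its proof,
whose clock is the factor `exp(K¹⁰t²/2 - K¹⁰)`). [`Tao2016AveragedNS`]
E. Hairer, S. P. Nørsett, G. Wanner, *Solving Ordinary Differential Equations I*, 2nd ed. (Springer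
1993), §I.10 (defects, approximate solutions). [`HairerNorsettWanner1993`]

HONEST FRAMING (cell pub-fluidc, verbatim): *low prior, high value-of-information experiment on
Tao's machine paradigm; NOT a claim that NS blows up.* Everything in this file is finite-dimensional
ODE theory about Tao's TOY circuit (5.5); nothing is asserted about the Navier–Stokes equations.

## Why this file exists (cell pub-fluidc, DICTIONARY.md §10; complements `GateFragility.lean`)

`GateFragility.lean` bounds the robustness radius of the gate (5.5) from the necessary side through
two channels: the SEED channel (defect sense: a forcing of sup-size `ε²e^{-K¹⁰}` cancelling the seed
stalls the clock; radius `≤ ε²e^{-K¹⁰}T`) and the PUMP-BIAS channel (kick sense, exact dynamics: a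
kick `2ε` in `b` delays the gate; timing-faithful kick radius `< 2ε`). Between the proved kick-sense
number `2ε` and the seed scale `ε²e^{-K¹⁰}` of the defect sense sits a factor `2ε⁻¹e^{K¹⁰}`. This
file removes the `e^{K¹⁰(1-o(1))}` part of that factor, through the channel the clock actually
listens to — the TRIGGER mode `c` itself.

* TRIGGER CHANNEL (kick sense, EXACT dynamics; `kickInit`, `kickThreshold`, `kick_core`,
  `not_hasAbruptTransition_of_kick`, `exists_kick_not_hasAbruptTransition`,
  `not_firesOnBudget_of_kickThreshold_le`). Start (5.5) from the
  energy-one datum `(√(1-κ²), 0, κ, 0, 0)`, at sup-distance `κ` from (5.6): the trigger is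
  pre-loaded, `c(0) = κ`, instead of being loaded by the seed `ε²e^{-K¹⁰}a²`. Inside the quiescent
  window of Theorem 5.3 (`a ≥ 1 - γ`, `γ = CK⁻¹⁰ ≤ 1/8`) one has `∂ₜb ≥ εr`, `b ≥ εrt`
  (`r = 1 - 2γ - 4K³⁰ε²`) as long as `c ≤ 2K¹⁰ε²`, and then the amplifier gives
  `c(t) ≥ κ·exp(K¹⁰rt²/2)`: the clock reads `exp(K¹⁰rt²/2 + log κ)` instead of Tao's
  `exp(K¹⁰t²/2 - K¹⁰ + 2 log ε)`. Under the THRESHOLD `κ ≥ kickThreshold K ε γ s₀ =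
  2K¹⁰ε²·exp(-K¹⁰rs₀²/2)`, `s₀ = √2 - (C+2)/√K`, the trigger reaches the level `2K¹⁰ε²` at a first
  hitting time `t_* ≤ s₀`; from then on `b ≥ 0` keeps `c ≥ 2K¹⁰ε²` (while `c ≤ 9K¹⁰ε²` by a
  Grönwall step of length `Δ = 1/(2K¹⁰)`), so the rotor `∂ₜd = ε⁻²ca - Kdã ≥ K¹⁰` turns `d` by at
  least `1/2` within `Δ` — still inside `[0, t_c - K^{-1/2}]`, where Theorem 5.3 demands
  `|d| ≤ CK⁻¹⁰ ≤ 1/8`. Contradiction: NO global solution from the kicked datum has the abrupt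
  transition with constants `C, K` (the kicked gate fires EARLY), and `FiresOnBudget K ε R T C θ r`
  fails for every budget `r ≥ kickThreshold K ε (CK⁻¹⁰ + θ) s₀`.
* SIZE OF THE THRESHOLD. `kickThreshold K ε γ s₀ = ε²e^{-K¹⁰} · 2K¹⁰exp(K¹⁰(1 - rs₀²/2))
  = ε²e^{-K¹⁰} · exp(√2(C+2)K^{9.5} - (C+2)²K⁹/2 + O(C + K⁴⁰ε² + log K))` for `γ = CK⁻¹⁰`: the
  SEED SCALE up to a factor `e^{O_C(K^{9.5})} = e^{o(K¹⁰)}`. In the stated range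
  `kickThreshold ≤ ε² < 2ε` (`kickThreshold_le_sq`, `kickThreshold_lt_two_mul_eps`).
* TRIVIAL CHANNELS (`not_hasAbruptTransition_of_lt_norm_sub`): a datum outside the sup-box of radius
  `CK⁻¹⁰` around (5.6) violates the first-window bound of Theorem 5.3 at `t = 0`. Kicks of the
  carrier `a`, the rotor variable `d` or the output `ã` are excluded above `CK⁻¹⁰` by definition
  (and harmless for the timing below it, heuristically).
* SANDWICH / PACKAGE (`shadowRadius_lt_kickThreshold`, `trigger_fragility`): granted Theorem 5.3 for
  `delaySolution K ε` (tree: `delaySolution_hasAbruptTransition`), the gate fires on the Grönwall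
  budget `shadowRadius` of `CircuitShadowing.lean` and on no budget `≥ kickThreshold`. Together with
  `gate_fragility` the robustness radius of Theorem 5.3's conclusion is pinned AT THE SEED SCALE
  `ε²e^{-K¹⁰(1-o(1))}` in both senses: defect (`≤ ε²e^{-K¹⁰}T`) and kick (`≤ kickThreshold`).

## The channel table (DICTIONARY.md §10, "Tao's circuit element ↔ gadget-interface field")

* kick into `c` (trigger): timing-faithful radius `≤ kickThreshold = ε²e^{-K¹⁰+O_C(K^{9.5})}` —
  EARLY firing (this file);
* kick into `b` (pump bias): radius `< 2ε` — LATE firing (`GateFragility.lean`);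
* kick into `a`, `d`, `ã`: radius `≤ CK⁻¹⁰` — the window bounds themselves (this file, trivial);
* defect, any mode: radius `≤ ε²e^{-K¹⁰}T` — STALLED clock (`GateFragility.lean`);
* sufficient side, all: radius `≥ shadowRadius = θe^{-delayLipschitz·T}` (`CircuitShadowing.lean`).

For the gadget dictionary: the interface field "admissible kick / defect into the trigger mode of a
delay element" must be budgeted at that element's OWN SEED SCALE, generation-uniformly. Tao's cascade
(Prop. 6.5) affords this only because its sole perturbations are the designed cross-level errors of
relative size `(1+ε₀)^{-n₀/2}` with `n₀` chosen LAST (DIVERGENCE.md D14; F2/F3).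

## What is NOT claimed

* The matching LOWER (tolerance) half — "kicks `κ ≤ ε²e^{-K¹⁰}·e^{cK^{9.5}}` still fire on time,
  with constants `O(C)`" — is NOT proved: it needs the bootstrap of the tree's proof of Theorem 5.3
  (`DelayCircuitHolds.lean`) re-run from `c(0) = κ`; it is recorded as a heuristic in
  DICTIONARY.md §10 only (no named fact, no conjecture declaration).
* Nothing about WHEN the kicked trajectory fires beyond "the window bounds fail before
  `t_c - K^{-1/2}`" (the heuristic early firing time `√(2 log(2K¹⁰ε²/κ)/K¹⁰)` is not formalised);
  nothing about structured forcing (`Stability.lean`); nothing about Navier–Stokes.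
* ANALOGY ONLY (used in no proof): the threshold law `K¹⁰rt_*²/2 + log κ ≈ log(2K¹⁰ε²)` is the
  entry–exit ("way-in/way-out", delayed loss of stability) bookkeeping of slow-passage problems
  (Neishtadt 1987/88; e.g. arXiv:2208.11559, §1), with Tao's tiny seed in the rôle of the buffer:
  a kick `κ` shortens the exit exactly as a shortened entry would.

## Design choices
* Conventions of `GateFragility.lean` (sup norm on `Fin 5 → ℝ`, `R : ℝ≥0`, `IsPseudoOrbit`,
  `FiresOnBudget`). The kicked trajectory is ANY global solution from `kickInit κ` (one exists:
  `exists_solution_kickInit`); no uniqueness is used.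
* Only the `Thm53` toolkit of `DelayCircuitHolds.lean` (integrating factors, one-sided derivative
  bounds, first hitting time), energy conservation and the numerical fact `e < 3`; constants
  explicit and unoptimised (`13K¹⁵ε ≤ 1`, `8γ ≤ 1`, level `2K¹⁰ε²`, step `1/(2K¹⁰)`, cap `9K¹⁰ε²`).
* The core lemma `kick_core` carries a generic window tolerance `γ ≤ 1/8` on `[0, s₀ + 1/(2K¹⁰)]`,
  so that it serves `HasAbruptTransition` (`γ = CK⁻¹⁰`) and `FiresOnBudget` (`γ = CK⁻¹⁰ + θ`) alike.
* No named facts, no axioms; two definitions (`kickInit`, `kickThreshold`).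

## References
* T. Tao, JAMS 29 (2016) 601–674, arXiv:1402.0290: §5.5 (5.5)/(5.6), Theorem 5.3 and its proof
  (the clock `e^{K¹⁰t²/2 - K¹⁰}`; roles of the seed and of the sign of `b`); §6.1; Prop. 6.5.
  [`Tao2016AveragedNS`]
* E. Hairer, S. P. Nørsett, G. Wanner, Solving ODE I (1993), §I.10. [`HairerNorsettWanner1993`]
-/

noncomputable section

open Set Metric Real
open scoped NNReal

namespace Literature.Analysis.FluidPDE.Tao2016AveragedNS

/-! ## A. The kicked datum and the kick threshold -/

/-- The **trigger-kicked datum** `(√(1-κ²), 0, κ, 0, 0)`: energy one, trigger mode `c` pre-loaded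
to `κ` (the designed datum (5.6) has `c(0) = 0`). [cite: Tao2016AveragedNS, §5.5 (5.6)] -/
def kickInit (κ : ℝ) : Fin 5 → ℝ := ![Real.sqrt (1 - κ ^ 2), 0, κ, 0, 0]

/-- The kicked datum has energy one (`κ² ≤ 1`). [cite: Tao2016AveragedNS, §5.5 (energy-con)] -/
theorem energy_kickInit {κ : ℝ} (hκ : κ ^ 2 ≤ 1) : energy (kickInit κ) = 1 := by
  have h : 0 ≤ 1 - κ ^ 2 := by linarith
  simp [energy, Fin.sum_univ_five, kickInit, Real.sq_sqrt h]

/-- The kicked datum differs from (5.6) by `(√(1-κ²) - 1, 0, κ, 0, 0)`.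
[cite: Tao2016AveragedNS, §5.5 (5.6)] -/
theorem kickInit_sub_delayInit (κ : ℝ) :
    kickInit κ - delayInit = ![Real.sqrt (1 - κ ^ 2) - 1, 0, κ, 0, 0] := by
  ext i
  fin_cases i <;> simp [kickInit, delayInit]

/-- The kicked datum is within sup-distance `κ` of (5.6) (`0 ≤ κ ≤ 1`; indeed `1 - √(1-κ²) ≤ κ`).
[cite: Tao2016AveragedNS, §5.5 (5.6)] -/
theorem norm_kickInit_sub_delayInit {κ : ℝ} (hκ0 : 0 ≤ κ) (hκ1 : κ ≤ 1) :
    ‖kickInit κ - delayInit‖ ≤ κ := by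
  have hlow : 1 - κ ≤ Real.sqrt (1 - κ ^ 2) := by
    calc 1 - κ = Real.sqrt ((1 - κ) ^ 2) := (Real.sqrt_sq (by linarith)).symm
      _ ≤ Real.sqrt (1 - κ ^ 2) := Real.sqrt_le_sqrt (by nlinarith)
  rw [kickInit_sub_delayInit]
  refine (pi_norm_le_iff_of_nonneg hκ0).2 fun i => ?_
  rw [Real.norm_eq_abs]
  have hup : Real.sqrt (1 - κ ^ 2) ≤ 1 := by
    simpa using Real.sqrt_le_sqrt (show 1 - κ ^ 2 ≤ 1 by nlinarith)
  have h0 : |Real.sqrt (1 - κ ^ 2) - 1| ≤ κ := by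
    rw [abs_sub_comm, abs_of_nonneg (by linarith)]; linarith
  have h2 : |κ| ≤ κ := (abs_of_nonneg hκ0).le
  fin_cases i
  · simpa using h0
  · simpa using hκ0
  · simpa using h2
  · simpa using hκ0
  · simpa using hκ0

/-- A global solution of (5.5) from the kicked datum exists (energy is conserved, the field is
polynomial). [cite: Tao2016AveragedNS, §5 (ode)–(g-cancel)] -/
theorem exists_solution_kickInit (K ε κ : ℝ) :
    ∃ X : ℝ → Fin 5 → ℝ, X 0 = kickInit κ ∧ ∀ t, HasDerivAt X (delayCircuit K ε (X t)) t :=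
  (isCancelling_delayCircuit K ε).exists_solution (contDiff_delayCircuit K ε) _

/-- The **kick threshold** of the trigger channel with window tolerance `γ` and quiescent length
`s`: `2K¹⁰ε² · exp(-K¹⁰(1 - 2γ - 4K³⁰ε²)s²/2)` — the smallest pre-load `κ` of `c` for which the
lower clock `κ·exp(K¹⁰rt²/2)` is guaranteed to reach the level `2K¹⁰ε²` by time `s`. For
`γ = CK⁻¹⁰`, `s = √2 - (C+2)/√K` it equals
`ε²e^{-K¹⁰} · exp(√2(C+2)K^{9.5} - (C+2)²K⁹/2 + O(C + K⁴⁰ε² + log K))` — the seed scale up to a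
factor `e^{o(K¹⁰)}`. [cite: Tao2016AveragedNS, §5.5 proof] -/
def kickThreshold (K ε γ s : ℝ) : ℝ :=
  2 * K ^ 10 * ε ^ 2 * exp (-(K ^ 10 * (1 - 2 * γ - 4 * K ^ 30 * ε ^ 2) * s ^ 2 / 2))

/-- The kick threshold is positive (`K, ε ≠ 0`). [folklore] -/
theorem kickThreshold_pos {K ε γ s : ℝ} (hK : 0 < K) (hε : 0 < ε) : 0 < kickThreshold K ε γ s := by
  unfold kickThreshold; positivity

/-- **The threshold is below `ε²`** once `K ≥ 2`, `13K¹⁵ε ≤ 1`, `γ ≤ 1/8` and the quiescent length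
is `≥ 1` (then the exponent is `≥ K¹⁰/4` and `e^{K¹⁰/4} ≥ K²⁰/32 ≥ 2K¹⁰`). [folklore] -/
theorem kickThreshold_le_sq {K ε γ s : ℝ} (hK : 2 ≤ K) (hε : 0 < ε) (hKε : 13 * K ^ 15 * ε ≤ 1)
    (hγ : γ ≤ 1 / 8) (hs : 1 ≤ s) : kickThreshold K ε γ s ≤ ε ^ 2 := by
  unfold kickThreshold
  set r : ℝ := 1 - 2 * γ - 4 * K ^ 30 * ε ^ 2 with hr
  have hK0 : 0 ≤ K ^ 10 := by positivity
  have hK1 : (1024 : ℝ) ≤ K ^ 10 := by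
    calc (1024 : ℝ) = 2 ^ 10 := by norm_num
      _ ≤ K ^ 10 := pow_le_pow_left₀ (by norm_num) hK 10
  have hKε2 : 169 * K ^ 30 * ε ^ 2 ≤ 1 := by
    have h13 : 0 ≤ 13 * K ^ 15 * ε := by positivity
    have : 169 * K ^ 30 * ε ^ 2 = (13 * K ^ 15 * ε) ^ 2 := by ring
    rw [this]; exact pow_le_one₀ h13 hKε
  have hr2 : 1 / 2 ≤ r := by rw [hr]; linarith
  have hs2 : 1 ≤ s ^ 2 := by nlinarith
  have hrs : 1 / 2 ≤ r * s ^ 2 := by nlinarith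
  have hE : K ^ 10 / 4 ≤ K ^ 10 * r * s ^ 2 / 2 := by
    have := mul_le_mul_of_nonneg_left hrs hK0
    have h' : K ^ 10 * r * s ^ 2 = K ^ 10 * (r * s ^ 2) := by ring
    rw [h']; linarith
  have hexp : 2 * K ^ 10 ≤ exp (K ^ 10 / 4) := by
    have hq := Real.quadratic_le_exp_of_nonneg (show (0 : ℝ) ≤ K ^ 10 / 4 by positivity)
    have h2 : 1024 * K ^ 10 ≤ K ^ 10 * K ^ 10 := by nlinarith
    nlinarith
  have hmain : 2 * K ^ 10 * exp (-(K ^ 10 * r * s ^ 2 / 2)) ≤ 1 := by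
    have h1 : exp (-(K ^ 10 * r * s ^ 2 / 2)) ≤ exp (-(K ^ 10 / 4)) := exp_le_exp.2 (by linarith)
    have h2 : 2 * K ^ 10 * exp (-(K ^ 10 / 4)) ≤ 1 := by
      rw [exp_neg, ← div_eq_mul_inv, div_le_one (exp_pos _)]
      exact hexp
    calc 2 * K ^ 10 * exp (-(K ^ 10 * r * s ^ 2 / 2)) ≤ 2 * K ^ 10 * exp (-(K ^ 10 / 4)) := by
          gcongr
      _ ≤ 1 := h2
  calc 2 * K ^ 10 * ε ^ 2 * exp (-(K ^ 10 * r * s ^ 2 / 2))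
      = ε ^ 2 * (2 * K ^ 10 * exp (-(K ^ 10 * r * s ^ 2 / 2))) := by ring
    _ ≤ ε ^ 2 * 1 := by gcongr
    _ = ε ^ 2 := mul_one _

/-- In the same range the trigger threshold is below the pump-bias threshold `2ε` of
`GateFragility.lean`. [folklore] -/
theorem kickThreshold_lt_two_mul_eps {K ε γ s : ℝ} (hK : 2 ≤ K) (hε : 0 < ε)
    (hKε : 13 * K ^ 15 * ε ≤ 1) (hγ : γ ≤ 1 / 8) (hs : 1 ≤ s) :
    kickThreshold K ε γ s < 2 * ε := by
  have hK15 : 1 ≤ K ^ 15 := one_le_pow₀ (by linarith : (1 : ℝ) ≤ K)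
  have hε1 : ε ≤ 1 := by nlinarith
  refine (kickThreshold_le_sq hK hε hKε hγ hs).trans_lt ?_
  nlinarith

section Kick

variable {K ε κ : ℝ} {X : ℝ → Fin 5 → ℝ}

/-- Energy conservation along the kicked trajectory. [cite: Tao2016AveragedNS, §5.5 (energy-con)] -/
theorem kick_energy (hX : ∀ t, HasDerivAt X (delayCircuit K ε (X t)) t) (h0 : X 0 = kickInit κ)
    (hκ : κ ^ 2 ≤ 1) (t : ℝ) : energy (X t) = 1 := by
  rw [energy_eq_of_isCancelling (isCancelling_delayCircuit K ε) hX t 0, h0, energy_kickInit hκ]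

/-- Each mode of the kicked trajectory has square at most one. [cite: Tao2016AveragedNS, §5.5] -/
theorem kick_sq_le_one (hX : ∀ t, HasDerivAt X (delayCircuit K ε (X t)) t)
    (h0 : X 0 = kickInit κ) (hκ : κ ^ 2 ≤ 1) (t : ℝ) (i : Fin 5) : X t i ^ 2 ≤ 1 := by
  have h := kick_energy hX h0 hκ t
  rw [energy] at h
  rw [← h]
  exact Finset.single_le_sum (f := fun j => X t j ^ 2) (fun j _ => sq_nonneg _) (Finset.mem_univ i)

/-- The kicked trajectory stays in the unit sup-ball. [cite: Tao2016AveragedNS, §5.5] -/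
theorem kick_norm_le_one (hX : ∀ t, HasDerivAt X (delayCircuit K ε (X t)) t)
    (h0 : X 0 = kickInit κ) (hκ : κ ^ 2 ≤ 1) (t : ℝ) : ‖X t‖ ≤ 1 := by
  have := norm_le_sqrt_energy (X t)
  rwa [kick_energy hX h0 hκ t, Real.sqrt_one] at this

/-- Initial values of the kicked trajectory. [cite: Tao2016AveragedNS, §5.5 (5.6)] -/
theorem kick_init_b (h0 : X 0 = kickInit κ) : X 0 1 = 0 := by simp [h0, kickInit]

/-- Initial values of the kicked trajectory. [cite: Tao2016AveragedNS, §5.5 (5.6)] -/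
theorem kick_init_c (h0 : X 0 = kickInit κ) : X 0 2 = κ := by simp [h0, kickInit]

/-- Initial values of the kicked trajectory. [cite: Tao2016AveragedNS, §5.5 (5.6)] -/
theorem kick_init_d (h0 : X 0 = kickInit κ) : X 0 3 = 0 := by simp [h0, kickInit]

/-- Initial values of the kicked trajectory. [cite: Tao2016AveragedNS, §5.5 (5.6)] -/
theorem kick_init_e (h0 : X 0 = kickInit κ) : X 0 4 = 0 := by simp [h0, kickInit]

/-- The pump variable obeys `b(t) ≤ εt` for `t ≥ 0` (`∂ₜb = εa² - ε⁻¹K¹⁰c² ≤ ε`).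
[cite: Tao2016AveragedNS, §5.5 (5.5) b-equation] -/
theorem kick_b_le (hX : ∀ t, HasDerivAt X (delayCircuit K ε (X t)) t) (h0 : X 0 = kickInit κ)
    (hκ : κ ^ 2 ≤ 1) (hε : 0 ≤ ε) {t : ℝ} (ht : 0 ≤ t) : X t 1 ≤ ε * t := by
  have hanti := Thm53.antitoneOn_sub_of_deriv_le (convex_Ici 0)
    (fun s _ => Thm53.hasDerivAt_b hX s) (fun s _ => (hasDerivAt_id s).const_mul ε)
    (fun s _ => by
      have ha : X s 0 ^ 2 ≤ 1 := kick_sq_le_one hX h0 hκ s 0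
      have h1 : ε * X s 0 ^ 2 ≤ ε := by simpa using mul_le_mul_of_nonneg_left ha hε
      have h2 : 0 ≤ ε⁻¹ * K ^ 10 * X s 2 ^ 2 := by
        have : 0 ≤ ε⁻¹ := inv_nonneg.2 hε
        positivity
      simpa using (show ε * X s 0 ^ 2 - ε⁻¹ * K ^ 10 * X s 2 ^ 2 ≤ ε by linarith))
  have hmono := hanti (self_mem_Ici (a := (0 : ℝ))) (mem_Ici.2 ht) ht
  simp only [kick_init_b h0, id, mul_zero, sub_zero] at hmono
  linarith

/-- **The trigger stays non-negative** (indeed `c(t) ≥ κ·exp(∫₀ᵗ ε⁻¹K¹⁰b) > 0`): integrating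
factor `exp(-∫₀ᵗ ε⁻¹K¹⁰b)`, as in the proof of Theorem 5.3. [cite: Tao2016AveragedNS, §5.5 proof] -/
theorem kick_c_nonneg (hX : ∀ t, HasDerivAt X (delayCircuit K ε (X t)) t) (h0 : X 0 = kickInit κ)
    (hκ0 : 0 ≤ κ) {t : ℝ} (ht : 0 ≤ t) : 0 ≤ X t 2 := by
  set G : ℝ → ℝ := fun s => ∫ r in (0 : ℝ)..s, ε⁻¹ * K ^ 10 * X r 1 with hG
  have hGd : ∀ s, HasDerivAt G (ε⁻¹ * K ^ 10 * X s 1) s := fun s =>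
    ((continuous_const.mul (Thm53.continuous_traj hX 1)).integral_hasStrictDerivAt 0 s).hasDerivAt
  have hmono := Thm53.monotoneOn_intFactor (s := univ) (φ := fun _ => 0) (Φ := fun _ => 0)
    convex_univ (fun s _ => Thm53.hasDerivAt_c hX s) (fun s _ => hGd s)
    (fun s _ => hasDerivAt_const s (0 : ℝ))
    (fun s _ => by
      have : (ε ^ 2 * exp (-K ^ 10) * X s 0 ^ 2 + ε⁻¹ * K ^ 10 * X s 1 * X s 2
          - ε⁻¹ * K ^ 10 * X s 1 * X s 2) * exp (-G s)
          = ε ^ 2 * exp (-K ^ 10) * X s 0 ^ 2 * exp (-G s) := by ring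
      rw [this]; positivity)
  have h := hmono (mem_univ 0) (mem_univ t) ht
  have hG0 : G 0 = 0 := by simp [hG]
  simp only [kick_init_c h0, hG0, neg_zero, exp_zero, mul_one, sub_zero] at h
  exact (mul_nonneg_iff_of_pos_right (exp_pos (-G t))).1 (hκ0.trans h)

/-- **Upper growth of the trigger** on `[t₁, 2]` (`t₁ ≥ 0`):
`c(t) ≤ e^{2K¹⁰(t-t₁)}(c(t₁) + ε²e^{-K¹⁰}(t - t₁))`, from `∂ₜc ≤ ε²e^{-K¹⁰} + 2K¹⁰c`
(`b ≤ εt ≤ 2ε`, `c ≥ 0`, `a² ≤ 1`). [cite: Tao2016AveragedNS, §5.5 (code)] -/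
theorem kick_c_growth (hX : ∀ t, HasDerivAt X (delayCircuit K ε (X t)) t) (h0 : X 0 = kickInit κ)
    (hκ0 : 0 ≤ κ) (hκ : κ ^ 2 ≤ 1) (hε : 0 < ε) {t₁ t : ℝ} (ht₁ : 0 ≤ t₁) (ht : t ∈ Icc t₁ 2) :
    X t 2 ≤ exp (2 * K ^ 10 * (t - t₁)) * (X t₁ 2 + ε ^ 2 * exp (-K ^ 10) * (t - t₁)) := by
  set μ : ℝ := ε ^ 2 * exp (-K ^ 10) with hμ
  have hμ0 : 0 ≤ μ := by positivity
  have hanti := Thm53.antitoneOn_intFactor (s := Icc t₁ 2) (f := fun s => X s 2)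
    (g := fun _ => 2 * K ^ 10) (G := fun s => 2 * K ^ 10 * (s - t₁)) (φ := fun _ => μ)
    (Φ := fun s => μ * (s - t₁)) (convex_Icc t₁ 2)
    (fun s _ => Thm53.hasDerivAt_c hX s)
    (fun s _ => (((hasDerivAt_id s).sub_const t₁).const_mul (2 * K ^ 10)).congr_deriv (by simp))
    (fun s _ => (((hasDerivAt_id s).sub_const t₁).const_mul μ).congr_deriv (by simp))
    (fun s hs => by
      have hs0 : 0 ≤ s := ht₁.trans hs.1
      have hc0 : 0 ≤ X s 2 := kick_c_nonneg hX h0 hκ0 hs0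
      have hb : X s 1 ≤ 2 * ε := (kick_b_le hX h0 hκ hε.le hs0).trans (by nlinarith [hs.2])
      have ha : X s 0 ^ 2 ≤ 1 := kick_sq_le_one hX h0 hκ s 0
      have hexp : exp (-(2 * K ^ 10 * (s - t₁))) ≤ 1 := by
        rw [exp_le_one_iff, neg_nonpos]
        have : 0 ≤ s - t₁ := by linarith [hs.1]
        positivity
      have hk : 0 ≤ K ^ 10 := by positivity
      have h1 : ε ^ 2 * exp (-K ^ 10) * X s 0 ^ 2 ≤ μ := by
        simpa [hμ] using mul_le_mul_of_nonneg_left ha (by positivity : 0 ≤ ε ^ 2 * exp (-K ^ 10))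
      have h2 : ε⁻¹ * K ^ 10 * X s 1 * X s 2 ≤ 2 * K ^ 10 * X s 2 := by
        have h5 : ε⁻¹ * X s 1 ≤ 2 := by rw [inv_mul_le_iff₀ hε]; linarith
        have : ε⁻¹ * K ^ 10 * X s 1 * X s 2 = (ε⁻¹ * X s 1) * (K ^ 10 * X s 2) := by ring
        rw [this]
        nlinarith [mul_nonneg hk hc0]
      have hbr : ε ^ 2 * exp (-K ^ 10) * X s 0 ^ 2 + ε⁻¹ * K ^ 10 * X s 1 * X s 2
          - 2 * K ^ 10 * X s 2 ≤ μ := by linarith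
      calc (ε ^ 2 * exp (-K ^ 10) * X s 0 ^ 2 + ε⁻¹ * K ^ 10 * X s 1 * X s 2
            - 2 * K ^ 10 * X s 2) * exp (-(2 * K ^ 10 * (s - t₁)))
          ≤ μ * exp (-(2 * K ^ 10 * (s - t₁))) := mul_le_mul_of_nonneg_right hbr (exp_pos _).le
        _ ≤ μ * 1 := mul_le_mul_of_nonneg_left hexp hμ0
        _ = μ := mul_one _)
  have h1mem : t₁ ∈ Icc t₁ 2 := ⟨le_rfl, ht.1.trans ht.2⟩
  have h := hanti h1mem ht ht.1
  simp only [sub_self, mul_zero, neg_zero, exp_zero, mul_one, sub_zero] at h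
  have h' : X t 2 * exp (-(2 * K ^ 10 * (t - t₁))) ≤ X t₁ 2 + μ * (t - t₁) := by linarith
  have hexp : X t 2 = X t 2 * exp (-(2 * K ^ 10 * (t - t₁))) * exp (2 * K ^ 10 * (t - t₁)) := by
    rw [mul_assoc, ← exp_add, neg_add_cancel, exp_zero, mul_one]
  rw [hexp]
  calc X t 2 * exp (-(2 * K ^ 10 * (t - t₁))) * exp (2 * K ^ 10 * (t - t₁))
      ≤ (X t₁ 2 + μ * (t - t₁)) * exp (2 * K ^ 10 * (t - t₁)) :=
        mul_le_mul_of_nonneg_right h' (exp_pos _).le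
    _ = exp (2 * K ^ 10 * (t - t₁)) * (X t₁ 2 + μ * (t - t₁)) := by ring

/-- Window step 1 — **the pump under the window bound**: if `a ≥ 1 - γ` (`γ ≤ 1`) and
`c ≤ 2K¹⁰ε²` hold on `[0, τ]`, then `b(t) ≥ ε(1 - 2γ - 4K³⁰ε²)t` there
(`∂ₜb = εa² - ε⁻¹K¹⁰c² ≥ ε(1-2γ) - 4K³⁰ε³`). [cite: Tao2016AveragedNS, §5.5 (5.5) b-equation] -/
theorem kick_b_lower (hX : ∀ t, HasDerivAt X (delayCircuit K ε (X t)) t) (h0 : X 0 = kickInit κ)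
    (hκ0 : 0 ≤ κ) (hε : 0 < ε) {γ τ : ℝ} (hγ : γ ≤ 1)
    (hWa : ∀ t ∈ Icc 0 τ, 1 - γ ≤ X t 0) (hc : ∀ t ∈ Icc 0 τ, X t 2 ≤ 2 * K ^ 10 * ε ^ 2)
    {t : ℝ} (ht : t ∈ Icc 0 τ) : ε * (1 - 2 * γ - 4 * K ^ 30 * ε ^ 2) * t ≤ X t 1 := by
  have hεne : ε ≠ 0 := hε.ne'
  have hmono := Thm53.monotoneOn_sub_of_le_deriv (s := Icc 0 τ) (f := fun t => X t 1)
    (φ := fun _ => ε * (1 - 2 * γ - 4 * K ^ 30 * ε ^ 2))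
    (Φ := fun t => ε * (1 - 2 * γ - 4 * K ^ 30 * ε ^ 2) * t) (convex_Icc 0 τ)
    (fun s _ => Thm53.hasDerivAt_b hX s)
    (fun s _ => ((hasDerivAt_id s).const_mul (ε * (1 - 2 * γ - 4 * K ^ 30 * ε ^ 2))).congr_deriv
      (by simp))
    (fun s hs => by
      show ε * (1 - 2 * γ - 4 * K ^ 30 * ε ^ 2) ≤ ε * X s 0 ^ 2 - ε⁻¹ * K ^ 10 * X s 2 ^ 2
      have ha : 1 - γ ≤ X s 0 := hWa s hs
      have hsq : (1 - γ) ^ 2 ≤ X s 0 ^ 2 := pow_le_pow_left₀ (by linarith) ha 2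
      have ha2 : 1 - 2 * γ ≤ X s 0 ^ 2 := by nlinarith [sq_nonneg γ]
      have hc0 : 0 ≤ X s 2 := kick_c_nonneg hX h0 hκ0 hs.1
      have hc2 : X s 2 ^ 2 ≤ (2 * K ^ 10 * ε ^ 2) ^ 2 := pow_le_pow_left₀ hc0 (hc s hs) 2
      have h3 : ε⁻¹ * K ^ 10 * X s 2 ^ 2 ≤ 4 * K ^ 30 * ε ^ 3 := by
        calc ε⁻¹ * K ^ 10 * X s 2 ^ 2 ≤ ε⁻¹ * K ^ 10 * (2 * K ^ 10 * ε ^ 2) ^ 2 :=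
              mul_le_mul_of_nonneg_left hc2 (by positivity)
          _ = 4 * K ^ 30 * ε ^ 3 := by field_simp; ring
      have h5 : ε * (1 - 2 * γ) ≤ ε * X s 0 ^ 2 := mul_le_mul_of_nonneg_left ha2 hε.le
      have h6 : ε * (1 - 2 * γ - 4 * K ^ 30 * ε ^ 2) = ε * (1 - 2 * γ) - 4 * K ^ 30 * ε ^ 3 := by
        ring
      rw [h6]; linarith)
  have h := hmono ⟨le_rfl, ht.1.trans ht.2⟩ ht ht.1
  simp only [kick_init_b h0, mul_zero, sub_zero] at h
  linarith

/-- Window step 2 — **the lower clock**: if `b(t) ≥ εrt` on `[0, τ]` then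
`c(t) ≥ κ·exp(K¹⁰rt²/2)` there (integrating factor `exp(-K¹⁰rt²/2)`; `c ≥ 0`). For the designed
datum this is Tao's `exp(K¹⁰t²/2 - K¹⁰)` clock with the seed replaced by the pre-load `κ`.
[cite: Tao2016AveragedNS, §5.5 proof] -/
theorem kick_c_lower (hX : ∀ t, HasDerivAt X (delayCircuit K ε (X t)) t) (h0 : X 0 = kickInit κ)
    (hκ0 : 0 ≤ κ) (hε : 0 < ε) {r τ : ℝ} (hb : ∀ t ∈ Icc 0 τ, ε * r * t ≤ X t 1)
    {t : ℝ} (ht : t ∈ Icc 0 τ) : κ * exp (K ^ 10 * r * t ^ 2 / 2) ≤ X t 2 := by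
  have hεne : ε ≠ 0 := hε.ne'
  have hmono := Thm53.monotoneOn_intFactor (s := Icc 0 τ) (f := fun t => X t 2)
    (g := fun t => K ^ 10 * r * t) (G := fun t => K ^ 10 * r * t ^ 2 / 2)
    (φ := fun _ => 0) (Φ := fun _ => 0) (convex_Icc 0 τ)
    (fun s _ => Thm53.hasDerivAt_c hX s)
    (fun s _ => by
      refine (((hasDerivAt_pow 2 s).const_mul (K ^ 10 * r)).div_const 2).congr_deriv ?_
      simp only [show (2 : ℕ) - 1 = 1 from rfl, pow_one, Nat.cast_ofNat]
      ring)
    (fun s _ => hasDerivAt_const s (0 : ℝ))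
    (fun s hs => by
      show (0 : ℝ) ≤ (ε ^ 2 * exp (-K ^ 10) * X s 0 ^ 2 + ε⁻¹ * K ^ 10 * X s 1 * X s 2
          - K ^ 10 * r * s * X s 2) * exp (-(K ^ 10 * r * s ^ 2 / 2))
      have hc0 : 0 ≤ X s 2 := kick_c_nonneg hX h0 hκ0 hs.1
      have h1 : K ^ 10 * r * s ≤ ε⁻¹ * K ^ 10 * X s 1 := by
        have := mul_le_mul_of_nonneg_left (hb s hs) (by positivity : 0 ≤ ε⁻¹ * K ^ 10)
        calc K ^ 10 * r * s = ε⁻¹ * K ^ 10 * (ε * r * s) := by field_simp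
          _ ≤ ε⁻¹ * K ^ 10 * X s 1 := this
      have h2 : 0 ≤ (ε⁻¹ * K ^ 10 * X s 1 - K ^ 10 * r * s) * X s 2 :=
        mul_nonneg (by linarith) hc0
      have h3 : 0 ≤ ε ^ 2 * exp (-K ^ 10) * X s 0 ^ 2 := by positivity
      have h4 : 0 ≤ ε ^ 2 * exp (-K ^ 10) * X s 0 ^ 2 + ε⁻¹ * K ^ 10 * X s 1 * X s 2
          - K ^ 10 * r * s * X s 2 := by
        have : ε ^ 2 * exp (-K ^ 10) * X s 0 ^ 2 + ε⁻¹ * K ^ 10 * X s 1 * X s 2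
            - K ^ 10 * r * s * X s 2 = ε ^ 2 * exp (-K ^ 10) * X s 0 ^ 2
              + (ε⁻¹ * K ^ 10 * X s 1 - K ^ 10 * r * s) * X s 2 := by ring
        rw [this]; exact add_nonneg h3 h2
      exact mul_nonneg h4 (exp_pos _).le)
  have h := hmono ⟨le_rfl, ht.1.trans ht.2⟩ ht ht.1
  simp only [kick_init_c h0, ne_eq, OfNat.ofNat_ne_zero, not_false_eq_true, zero_pow, mul_zero,
    zero_div, neg_zero, exp_zero, mul_one, sub_zero] at h
  calc κ * exp (K ^ 10 * r * t ^ 2 / 2)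
      ≤ X t 2 * exp (-(K ^ 10 * r * t ^ 2 / 2)) * exp (K ^ 10 * r * t ^ 2 / 2) :=
        mul_le_mul_of_nonneg_right h (exp_pos _).le
    _ = X t 2 := by rw [mul_assoc, ← exp_add, neg_add_cancel, exp_zero, mul_one]

/-- Window step 3 — **the pump keeps its sign**: if `a ≥ 1 - γ` (`γ ≤ 1/8`) and `c ≤ 9K¹⁰ε²` hold
on `[0, T₂]` (`13K¹⁵ε ≤ 1`), then `b ≥ 0` there (`∂ₜb ≥ ε(3/4) - 81K³⁰ε³ ≥ 0`).
[cite: Tao2016AveragedNS, §5.5 (5.5) b-equation] -/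
theorem kick_b_nonneg (hX : ∀ t, HasDerivAt X (delayCircuit K ε (X t)) t) (h0 : X 0 = kickInit κ)
    (hκ0 : 0 ≤ κ) (hK : 0 ≤ K) (hε : 0 < ε) (hKε : 13 * K ^ 15 * ε ≤ 1) {γ T₂ : ℝ}
    (hγ : γ ≤ 1 / 8) (hWa : ∀ t ∈ Icc 0 T₂, 1 - γ ≤ X t 0)
    (hc : ∀ t ∈ Icc 0 T₂, X t 2 ≤ 9 * K ^ 10 * ε ^ 2) {t : ℝ} (ht : t ∈ Icc 0 T₂) :
    0 ≤ X t 1 := by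
  have hεne : ε ≠ 0 := hε.ne'
  have hKε2 : 169 * K ^ 30 * ε ^ 2 ≤ 1 := by
    have h13 : 0 ≤ 13 * K ^ 15 * ε := by positivity
    have : 169 * K ^ 30 * ε ^ 2 = (13 * K ^ 15 * ε) ^ 2 := by ring
    rw [this]; exact pow_le_one₀ h13 hKε
  have hmono := Thm53.monotoneOn_sub_of_le_deriv (s := Icc 0 T₂) (f := fun t => X t 1)
    (φ := fun _ => 0) (Φ := fun _ => 0) (convex_Icc 0 T₂)
    (fun s _ => Thm53.hasDerivAt_b hX s) (fun s _ => hasDerivAt_const s (0 : ℝ))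
    (fun s hs => by
      show (0 : ℝ) ≤ ε * X s 0 ^ 2 - ε⁻¹ * K ^ 10 * X s 2 ^ 2
      have ha : 1 - γ ≤ X s 0 := hWa s hs
      have hsq : (1 - γ) ^ 2 ≤ X s 0 ^ 2 := pow_le_pow_left₀ (by linarith) ha 2
      have ha2 : 1 - 2 * γ ≤ X s 0 ^ 2 := by nlinarith [sq_nonneg γ]
      have hc0 : 0 ≤ X s 2 := kick_c_nonneg hX h0 hκ0 hs.1
      have hc2 : X s 2 ^ 2 ≤ (9 * K ^ 10 * ε ^ 2) ^ 2 := pow_le_pow_left₀ hc0 (hc s hs) 2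
      have h3 : ε⁻¹ * K ^ 10 * X s 2 ^ 2 ≤ 81 * K ^ 30 * ε ^ 3 := by
        calc ε⁻¹ * K ^ 10 * X s 2 ^ 2 ≤ ε⁻¹ * K ^ 10 * (9 * K ^ 10 * ε ^ 2) ^ 2 :=
              mul_le_mul_of_nonneg_left hc2 (by positivity)
          _ = 81 * K ^ 30 * ε ^ 3 := by field_simp; ring
      have h4 : 81 * K ^ 30 * ε ^ 3 ≤ ε * (1 / 2) := by
        have h81 : 81 * K ^ 30 * ε ^ 2 ≤ 1 / 2 := by
          have : 0 ≤ K ^ 30 * ε ^ 2 := by positivity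
          linarith
        have : 81 * K ^ 30 * ε ^ 3 = ε * (81 * K ^ 30 * ε ^ 2) := by ring
        rw [this]; exact mul_le_mul_of_nonneg_left h81 hε.le
      have h5 : ε * (3 / 4) ≤ ε * X s 0 ^ 2 := mul_le_mul_of_nonneg_left (by linarith) hε.le
      linarith)
  have h := hmono ⟨le_rfl, ht.1.trans ht.2⟩ ht ht.1
  simp only [kick_init_b h0, sub_zero] at h
  exact h

/-- Window step 4 — **the trigger holds its level**: if `b ≥ 0` on `[0, T₂]` then `c` is
non-decreasing there (`∂ₜc = ε²e^{-K¹⁰}a² + ε⁻¹K¹⁰bc ≥ 0`). [cite: Tao2016AveragedNS, §5.5 proof] -/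
theorem kick_c_monotoneOn (hX : ∀ t, HasDerivAt X (delayCircuit K ε (X t)) t)
    (h0 : X 0 = kickInit κ) (hκ0 : 0 ≤ κ) (hε : 0 ≤ ε) {T₂ : ℝ}
    (hb : ∀ t ∈ Icc 0 T₂, 0 ≤ X t 1) : MonotoneOn (fun t => X t 2) (Icc 0 T₂) := by
  have hmono := Thm53.monotoneOn_sub_of_le_deriv (s := Icc 0 T₂) (f := fun t => X t 2)
    (φ := fun _ => 0) (Φ := fun _ => 0) (convex_Icc 0 T₂)
    (fun s _ => Thm53.hasDerivAt_c hX s) (fun s _ => hasDerivAt_const s (0 : ℝ))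
    (fun s hs => by
      show (0 : ℝ) ≤ ε ^ 2 * exp (-K ^ 10) * X s 0 ^ 2 + ε⁻¹ * K ^ 10 * X s 1 * X s 2
      have hc0 : 0 ≤ X s 2 := kick_c_nonneg hX h0 hκ0 hs.1
      have hb0 : 0 ≤ X s 1 := hb s hs
      have : 0 ≤ ε⁻¹ := inv_nonneg.2 hε
      positivity)
  simpa using hmono

/-- Window step 5 — **the rotor turns**: if on `[τ, τ + Δ]` one has `c ≥ 2K¹⁰ε²`, `a ≥ 1 - γ` and
`|d|, |ã| ≤ γ` (`γ ≤ 1/8`, `K ≥ 1`), then `∂ₜd = ε⁻²ca - Kdã ≥ K¹⁰` and `d(τ + Δ) ≥ d(τ) + K¹⁰Δ`.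
[cite: Tao2016AveragedNS, §5.5 (5.5) d-equation] -/
theorem kick_d_growth (hX : ∀ t, HasDerivAt X (delayCircuit K ε (X t)) t) (hK : 1 ≤ K)
    (hε : 0 < ε) {γ τ Δ : ℝ} (hγ : γ ≤ 1 / 8) (hΔ : 0 ≤ Δ)
    (hc : ∀ t ∈ Icc τ (τ + Δ), 2 * K ^ 10 * ε ^ 2 ≤ X t 2)
    (hW : ∀ t ∈ Icc τ (τ + Δ), 1 - γ ≤ X t 0 ∧ |X t 3| ≤ γ ∧ |X t 4| ≤ γ) :
    X τ 3 + K ^ 10 * Δ ≤ X (τ + Δ) 3 := by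
  have hεne : ε ≠ 0 := hε.ne'
  have hK0 : 0 < K := by linarith
  have hKK : K ≤ K ^ 10 := by
    calc K = K ^ 1 := (pow_one K).symm
      _ ≤ K ^ 10 := pow_le_pow_right₀ hK (by norm_num)
  have hγ0 : 0 ≤ γ := (abs_nonneg _).trans (hW τ ⟨le_rfl, by linarith⟩).2.1
  have hmono := Thm53.monotoneOn_sub_of_le_deriv (s := Icc τ (τ + Δ)) (f := fun t => X t 3)
    (φ := fun _ => K ^ 10) (Φ := fun t => K ^ 10 * t) (convex_Icc τ (τ + Δ))
    (fun s _ => Thm53.hasDerivAt_d hX s)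
    (fun s _ => ((hasDerivAt_id s).const_mul (K ^ 10)).congr_deriv (by simp))
    (fun s hs => by
      show K ^ 10 ≤ (ε ^ 2)⁻¹ * X s 2 * X s 0 - K * X s 3 * X s 4
      obtain ⟨ha, hd, he⟩ := hW s hs
      have hcs : 2 * K ^ 10 * ε ^ 2 ≤ X s 2 := hc s hs
      have hc₁0 : (0 : ℝ) ≤ 2 * K ^ 10 * ε ^ 2 := by positivity
      have hca : 2 * K ^ 10 * ε ^ 2 * (1 - γ) ≤ X s 2 * X s 0 :=
        mul_le_mul hcs ha (by linarith) (hc₁0.trans hcs)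
      have h1 : 2 * K ^ 10 * (1 - γ) ≤ (ε ^ 2)⁻¹ * X s 2 * X s 0 := by
        calc 2 * K ^ 10 * (1 - γ) = (ε ^ 2)⁻¹ * (2 * K ^ 10 * ε ^ 2 * (1 - γ)) := by field_simp
          _ ≤ (ε ^ 2)⁻¹ * (X s 2 * X s 0) := mul_le_mul_of_nonneg_left hca (by positivity)
          _ = (ε ^ 2)⁻¹ * X s 2 * X s 0 := by ring
      have h2 : K * X s 3 * X s 4 ≤ K * γ ^ 2 := by
        have : X s 3 * X s 4 ≤ γ ^ 2 := by
          calc X s 3 * X s 4 ≤ |X s 3 * X s 4| := le_abs_self _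
            _ = |X s 3| * |X s 4| := abs_mul _ _
            _ ≤ γ * γ := mul_le_mul hd he (abs_nonneg _) hγ0
            _ = γ ^ 2 := (sq γ).symm
        calc K * X s 3 * X s 4 = K * (X s 3 * X s 4) := by ring
          _ ≤ K * γ ^ 2 := mul_le_mul_of_nonneg_left this hK0.le
      have h3 : K * γ ^ 2 ≤ K ^ 10 * (1 / 64) := by
        have hγ2 : γ ^ 2 ≤ 1 / 64 := by nlinarith
        calc K * γ ^ 2 ≤ K * (1 / 64) := mul_le_mul_of_nonneg_left hγ2 hK0.le
          _ ≤ K ^ 10 * (1 / 64) := mul_le_mul_of_nonneg_right hKK (by norm_num)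
      have h4 : K ^ 10 * γ ≤ K ^ 10 * (1 / 8) := mul_le_mul_of_nonneg_left hγ (by positivity)
      have h5 : 2 * K ^ 10 * (1 - γ) = 2 * K ^ 10 - 2 * (K ^ 10 * γ) := by ring
      have hk : 0 ≤ K ^ 10 := by positivity
      linarith)
  have h := hmono ⟨le_rfl, by linarith⟩ ⟨by linarith, le_rfl⟩ (by linarith)
  have h5 : K ^ 10 * (τ + Δ) = K ^ 10 * τ + K ^ 10 * Δ := by ring
  simp only at h
  linarith

/-- **Core of the trigger channel.** For a global solution of (5.5) from `kickInit κ` with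
`kickThreshold K ε γ s₀ ≤ κ ≤ ε²` (`K ≥ 1`, `13K¹⁵ε ≤ 1`, `γ ≤ 1/8`, `0 < s₀`, `s₀ + 1/(2K¹⁰) ≤ 2`),
the window bounds `a ≥ 1 - γ`, `|d| ≤ γ`, `|ã| ≤ γ` CANNOT hold on all of `[0, s₀ + 1/(2K¹⁰)]`:
the trigger reaches `2K¹⁰ε²` by a time `t_* ≤ s₀` (lower clock `κe^{K¹⁰rt²/2}`, first hitting
time), stays in `[2K¹⁰ε², 9K¹⁰ε²]` on `[t_*, t_* + 1/(2K¹⁰)]` (`b ≥ 0`; Grönwall), and the rotor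
`∂ₜd ≥ K¹⁰` moves `d` by `≥ 1/2 > 2γ`. [cite: Tao2016AveragedNS, §5.5 proof] -/
theorem kick_core (hX : ∀ t, HasDerivAt X (delayCircuit K ε (X t)) t) (h0 : X 0 = kickInit κ)
    (hK : 1 ≤ K) (hε : 0 < ε) (hKε : 13 * K ^ 15 * ε ≤ 1) (hκ0 : 0 < κ) (hκ : κ ≤ ε ^ 2)
    {γ s₀ : ℝ} (hγ : γ ≤ 1 / 8) (hs₀ : 0 < s₀) (hs2 : s₀ + 1 / (2 * K ^ 10) ≤ 2)
    (hthr : kickThreshold K ε γ s₀ ≤ κ)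
    (hW : ∀ t ∈ Icc 0 (s₀ + 1 / (2 * K ^ 10)), 1 - γ ≤ X t 0 ∧ |X t 3| ≤ γ ∧ |X t 4| ≤ γ) :
    False := by
  set Δ : ℝ := 1 / (2 * K ^ 10) with hΔ
  -- arithmetic of the constants
  have hK0 : 0 < K := by linarith
  have hKne : K ≠ 0 := hK0.ne'
  have hK10 : 1 ≤ K ^ 10 := one_le_pow₀ hK
  have hK15 : 1 ≤ K ^ 15 := one_le_pow₀ hK
  have hΔ0 : 0 < Δ := by positivity
  have hΔ1 : Δ ≤ 1 / 2 := one_div_le_one_div_of_le (by norm_num) (by linarith)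
  have hKΔ : K ^ 10 * Δ = 1 / 2 := by rw [hΔ]; field_simp
  have hε1 : 13 * ε ≤ 1 := by nlinarith
  have hε2 : 0 < ε ^ 2 := by positivity
  have hεsq : ε ^ 2 ≤ 1 := by nlinarith
  have hκ1 : κ ≤ 1 := hκ.trans hεsq
  have hκsq : κ ^ 2 ≤ 1 := by nlinarith
  have hεK : ε ^ 2 ≤ K ^ 10 * ε ^ 2 := le_mul_of_one_le_left hε2.le hK10
  have hσε : ε ^ 2 * exp (-K ^ 10) ≤ ε ^ 2 := by
    have : exp (-K ^ 10) ≤ 1 := by rw [exp_le_one_iff, neg_nonpos]; positivity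
    simpa using mul_le_mul_of_nonneg_left this hε2.le
  have hσ0 : 0 ≤ ε ^ 2 * exp (-K ^ 10) := by positivity
  have hκc₁ : κ < 2 * K ^ 10 * ε ^ 2 := hκ.trans_lt (by linarith)
  -- the first hitting time `τ ≤ s₀` of the level `2K¹⁰ε²` by the trigger
  have hcont : Continuous fun t => X t 2 := Thm53.continuous_traj hX 2
  have hc00 : X 0 2 < 2 * K ^ 10 * ε ^ 2 := by rw [kick_init_c h0]; exact hκc₁
  obtain ⟨τ, hτ0, hτs, hcle, hhit⟩ :=
    Thm53.exists_hitTime (u := fun t => X t 2) (θ := 2 * K ^ 10 * ε ^ 2) hcont hs₀ hc00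
  have hτW : τ ≤ s₀ + Δ := by linarith
  have hτΔW : τ + Δ ≤ s₀ + Δ := by linarith
  -- steps 1–2 on `[0, τ]`: `b ≥ εrt`, `c ≥ κe^{K¹⁰rt²/2}`; hence `c(τ) ≥ 2K¹⁰ε²`
  have hP1b : ∀ t ∈ Icc 0 τ, ε * (1 - 2 * γ - 4 * K ^ 30 * ε ^ 2) * t ≤ X t 1 := fun t ht =>
    kick_b_lower hX h0 hκ0.le hε (by linarith) (fun s hs => (hW s ⟨hs.1, hs.2.trans hτW⟩).1)
      (fun s hs => hcle s hs.1 hs.2) ht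
  have hcτ : 2 * K ^ 10 * ε ^ 2 ≤ X τ 2 := by
    rcases hτs.lt_or_eq with hlt | heq
    · exact (hhit hlt).ge
    · have h := kick_c_lower hX h0 hκ0.le hε hP1b (t := τ) ⟨hτ0.le, le_rfl⟩
      have h1 : kickThreshold K ε γ s₀ *
          exp (K ^ 10 * (1 - 2 * γ - 4 * K ^ 30 * ε ^ 2) * s₀ ^ 2 / 2) = 2 * K ^ 10 * ε ^ 2 := by
        rw [kickThreshold, mul_assoc (2 * K ^ 10 * ε ^ 2), ← exp_add, neg_add_cancel, exp_zero,
          mul_one]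
      rw [heq] at h ⊢
      calc 2 * K ^ 10 * ε ^ 2
          = kickThreshold K ε γ s₀ *
              exp (K ^ 10 * (1 - 2 * γ - 4 * K ^ 30 * ε ^ 2) * s₀ ^ 2 / 2) := h1.symm
        _ ≤ κ * exp (K ^ 10 * (1 - 2 * γ - 4 * K ^ 30 * ε ^ 2) * s₀ ^ 2 / 2) :=
            mul_le_mul_of_nonneg_right hthr (exp_pos _).le
        _ ≤ X s₀ 2 := h
  -- Grönwall step: `c ≤ 9K¹⁰ε²` on `[0, τ + Δ]`
  have hc3 : ∀ t ∈ Icc 0 (τ + Δ), X t 2 ≤ 9 * K ^ 10 * ε ^ 2 := by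
    intro t ht
    rcases le_or_gt t τ with htτ | htτ
    · exact (hcle t ht.1 htτ).trans (by linarith)
    · have hg := kick_c_growth hX h0 hκ0.le hκsq hε hτ0.le ⟨htτ.le, by linarith [ht.2]⟩
      have hdt : t - τ ≤ Δ := by linarith [ht.2]
      have hdt0 : 0 ≤ t - τ := by linarith
      have he1 : exp (2 * K ^ 10 * (t - τ)) ≤ 3 := by
        have h1 : K ^ 10 * (t - τ) ≤ K ^ 10 * Δ := mul_le_mul_of_nonneg_left hdt (by positivity)
        have : 2 * K ^ 10 * (t - τ) ≤ 1 := by linarith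
        calc exp (2 * K ^ 10 * (t - τ)) ≤ exp 1 := exp_le_exp.2 this
          _ ≤ 3 := (Real.exp_one_lt_d9.trans (by norm_num)).le
      have hcτ1 : X τ 2 ≤ 2 * K ^ 10 * ε ^ 2 := hcle τ hτ0.le le_rfl
      have hσ1 : ε ^ 2 * exp (-K ^ 10) * (t - τ) ≤ ε ^ 2 := by
        have : t - τ ≤ 1 := by linarith
        calc ε ^ 2 * exp (-K ^ 10) * (t - τ) ≤ ε ^ 2 * exp (-K ^ 10) * 1 :=
              mul_le_mul_of_nonneg_left this hσ0
          _ ≤ ε ^ 2 := by rw [mul_one]; exact hσε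
      have hsum : X τ 2 + ε ^ 2 * exp (-K ^ 10) * (t - τ) ≤ 3 * K ^ 10 * ε ^ 2 := by linarith
      have hsum0 : 0 ≤ X τ 2 + ε ^ 2 * exp (-K ^ 10) * (t - τ) := by
        have := kick_c_nonneg hX h0 hκ0.le hτ0.le; positivity
      calc X t 2 ≤ exp (2 * K ^ 10 * (t - τ)) * (X τ 2 + ε ^ 2 * exp (-K ^ 10) * (t - τ)) := hg
        _ ≤ 3 * (3 * K ^ 10 * ε ^ 2) := mul_le_mul he1 hsum hsum0 (by norm_num)
        _ = 9 * K ^ 10 * ε ^ 2 := by ring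
  -- steps 3–4 on `[0, τ + Δ]`: `b ≥ 0`, `c` non-decreasing, so `c ≥ 2K¹⁰ε²` on `[τ, τ + Δ]`
  have hb0 : ∀ t ∈ Icc 0 (τ + Δ), 0 ≤ X t 1 := fun t ht =>
    kick_b_nonneg hX h0 hκ0.le hK0.le hε hKε hγ (fun s hs => (hW s ⟨hs.1, hs.2.trans hτΔW⟩).1)
      hc3 ht
  have hcm := kick_c_monotoneOn hX h0 hκ0.le hε.le hb0
  have hcge : ∀ t ∈ Icc τ (τ + Δ), 2 * K ^ 10 * ε ^ 2 ≤ X t 2 := fun t ht =>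
    hcτ.trans (hcm ⟨hτ0.le, by linarith⟩ ⟨hτ0.le.trans ht.1, ht.2⟩ ht.1)
  -- step 5: the rotor turns `d` by `K¹⁰Δ = 1/2 > 2γ` inside the window
  have hd1 : X τ 3 + K ^ 10 * Δ ≤ X (τ + Δ) 3 :=
    kick_d_growth hX hK hε hγ hΔ0.le hcge fun t ht => hW t ⟨hτ0.le.trans ht.1, ht.2.trans hτΔW⟩
  have hdτ : -γ ≤ X τ 3 := (abs_le.1 (hW τ ⟨hτ0.le, hτW⟩).2.1).1
  have hdend : X (τ + Δ) 3 ≤ γ := (abs_le.1 (hW (τ + Δ) ⟨by linarith, hτΔW⟩).2.1).2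
  linarith

/-- **The kicked trajectory does not perform the designed abrupt transition.** For `K ≥ 1`,
`13K¹⁵ε ≤ 1`, `8C ≤ K¹⁰`, `(C+2)/√K < √2` and a trigger kick
`kickThreshold K ε (CK⁻¹⁰) (√2 - (C+2)/√K) ≤ κ ≤ ε²`, NO global solution of (5.5) from `kickInit κ`
satisfies the conclusion of Theorem 5.3 with constants `C, K`: the window bound `|d| ≤ CK⁻¹⁰` fails
before `t_c - K^{-1/2}` (the gate fires early). [cite: Tao2016AveragedNS, Theorem 5.3] -/
theorem not_hasAbruptTransition_of_kick {C : ℝ}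
    (hX : ∀ t, HasDerivAt X (delayCircuit K ε (X t)) t) (h0 : X 0 = kickInit κ) (hK : 1 ≤ K)
    (hε : 0 < ε) (hKε : 13 * K ^ 15 * ε ≤ 1) (hκ0 : 0 < κ) (hκ : κ ≤ ε ^ 2) (hC : 0 ≤ C)
    (hC8 : 8 * C ≤ K ^ 10) (hCK : (C + 2) / Real.sqrt K < Real.sqrt 2)
    (hthr : kickThreshold K ε (C / K ^ 10) (Real.sqrt 2 - (C + 2) / Real.sqrt K) ≤ κ) :
    ¬ HasAbruptTransition C K X := by
  rintro ⟨tc, htc, hwin, -⟩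
  set s₀ := Real.sqrt 2 - (C + 2) / Real.sqrt K with hs₀
  have hK0 : 0 < K := by linarith
  have hsK : 0 < Real.sqrt K := Real.sqrt_pos.2 hK0
  have hK10 : 1 ≤ K ^ 10 := one_le_pow₀ hK
  have hγ : C / K ^ 10 ≤ 1 / 8 := by rw [div_le_iff₀ (by positivity)]; linarith
  have hs₀pos : 0 < s₀ := by rw [hs₀]; linarith
  have hsqK : Real.sqrt K ≤ K := by
    calc Real.sqrt K ≤ Real.sqrt (K ^ 2) := Real.sqrt_le_sqrt (by nlinarith)
      _ = K := Real.sqrt_sq hK0.le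
  have hKK : K ≤ K ^ 10 := by
    calc K = K ^ 1 := (pow_one K).symm
      _ ≤ K ^ 10 := pow_le_pow_right₀ hK (by norm_num)
  have hΔ : 1 / (2 * K ^ 10) ≤ 1 / Real.sqrt K :=
    one_div_le_one_div_of_le hsK (by linarith)
  have hΔ2 : 1 / (2 * K ^ 10) ≤ 1 / 2 := one_div_le_one_div_of_le (by norm_num) (by linarith)
  have h22 : Real.sqrt 2 ≤ 3 / 2 := by
    calc Real.sqrt 2 ≤ Real.sqrt ((3 / 2) ^ 2) := Real.sqrt_le_sqrt (by norm_num)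
      _ = 3 / 2 := Real.sqrt_sq (by norm_num)
  have hpos : 0 ≤ (C + 2) / Real.sqrt K := div_nonneg (by linarith) hsK.le
  have hs2 : s₀ + 1 / (2 * K ^ 10) ≤ 2 := by rw [hs₀]; linarith
  have htc1 : Real.sqrt 2 - C / Real.sqrt K ≤ tc := by
    have := (abs_sub_le_iff.1 htc).2; linarith
  have hsplit : (C + 2) / Real.sqrt K = C / Real.sqrt K + 1 / Real.sqrt K + 1 / Real.sqrt K := by
    ring
  have hwin' : s₀ + 1 / (2 * K ^ 10) ≤ tc - 1 / Real.sqrt K := by rw [hs₀]; linarith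
  refine kick_core hX h0 hK hε hKε hκ0 hκ hγ hs₀pos hs2 hthr fun t ht => ?_
  obtain ⟨ha, hrest⟩ := hwin t ⟨ht.1, ht.2.trans hwin'⟩
  exact ⟨by have := (abs_sub_le_iff.1 ha).2; linarith, hrest 3 (by decide), hrest 4 (by decide)⟩

end Kick

/-- **Kick fragility of Theorem 5.3's conclusion, trigger channel.** For every kick size `κ` with
`kickThreshold K ε (CK⁻¹⁰) (√2 - (C+2)/√K) ≤ κ ≤ ε²` there is a global solution of (5.5) issued
within sup-distance `κ` of (5.6), staying in the unit ball, WITHOUT the delayed abrupt transition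
with constants `C, K`. [cite: Tao2016AveragedNS, Theorem 5.3] -/
theorem exists_kick_not_hasAbruptTransition {K ε κ C : ℝ} (hK : 1 ≤ K) (hε : 0 < ε)
    (hKε : 13 * K ^ 15 * ε ≤ 1) (hκ0 : 0 < κ) (hκ : κ ≤ ε ^ 2) (hC : 0 ≤ C)
    (hC8 : 8 * C ≤ K ^ 10) (hCK : (C + 2) / Real.sqrt K < Real.sqrt 2)
    (hthr : kickThreshold K ε (C / K ^ 10) (Real.sqrt 2 - (C + 2) / Real.sqrt K) ≤ κ) :
    ∃ X : ℝ → Fin 5 → ℝ, (∀ t, HasDerivAt X (delayCircuit K ε (X t)) t) ∧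
      ‖X 0 - delayInit‖ ≤ κ ∧ (∀ t, ‖X t‖ ≤ 1) ∧ ¬ HasAbruptTransition C K X := by
  obtain ⟨X, h0, hX⟩ := exists_solution_kickInit K ε κ
  have hK15 : 1 ≤ K ^ 15 := one_le_pow₀ hK
  have hε1 : 13 * ε ≤ 1 := by nlinarith
  have hκ1 : κ ≤ 1 := hκ.trans (by nlinarith)
  have hκsq : κ ^ 2 ≤ 1 := by nlinarith
  exact ⟨X, hX, h0 ▸ norm_kickInit_sub_delayInit hκ0.le hκ1, kick_norm_le_one hX h0 hκsq,
    not_hasAbruptTransition_of_kick hX h0 hK hε hKε hκ0 hκ hC hC8 hCK hthr⟩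

/-- **Necessity, trigger channel.** No firing statement `FiresOnBudget K ε R T C θ r` survives a
budget `r ≥ kickThreshold K ε (CK⁻¹⁰ + θ) (√2 - (C+2)/√K)` (window `T ≥ 2`, ball `R ≥ 1`, `K ≥ 1`,
`13K¹⁵ε ≤ 1`, tolerance `8(CK⁻¹⁰ + θ) ≤ 1`, `(C+2)/√K < √2`, threshold `≤ ε²`): the exact trajectory
from the threshold kick is an admissible `0`-pseudo-orbit whose window bounds fail before
`t_c - K^{-1/2}`. So the timing-faithful kick-robustness radius of the gate is below its trigger
threshold, i.e. at the seed scale `ε²e^{-K¹⁰ + O_C(K^{9.5})}`. [cite: Tao2016AveragedNS, Theorem 5.3] -/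
theorem not_firesOnBudget_of_kickThreshold_le {K ε T C θ r : ℝ} {R : ℝ≥0} (hR : 1 ≤ R)
    (hK : 1 ≤ K) (hε : 0 < ε) (hKε : 13 * K ^ 15 * ε ≤ 1) (hC : 0 ≤ C)
    (hγ : 8 * (C / K ^ 10 + θ) ≤ 1) (hCK : (C + 2) / Real.sqrt K < Real.sqrt 2) (hT : 2 ≤ T)
    (hthr : kickThreshold K ε (C / K ^ 10 + θ) (Real.sqrt 2 - (C + 2) / Real.sqrt K) ≤ ε ^ 2)
    (hr : kickThreshold K ε (C / K ^ 10 + θ) (Real.sqrt 2 - (C + 2) / Real.sqrt K) ≤ r) :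
    ¬ FiresOnBudget K ε R T C θ r := by
  intro h
  set s₀ := Real.sqrt 2 - (C + 2) / Real.sqrt K with hs₀
  set κ := kickThreshold K ε (C / K ^ 10 + θ) s₀ with hκdef
  have hK0 : 0 < K := by linarith
  have hκ0 : 0 < κ := kickThreshold_pos hK0 hε
  obtain ⟨X, h0, hX⟩ := exists_solution_kickInit K ε κ
  have hK15 : 1 ≤ K ^ 15 := one_le_pow₀ hK
  have hε1 : 13 * ε ≤ 1 := by nlinarith
  have hκ1 : κ ≤ 1 := hthr.trans (by nlinarith)
  have hκsq : κ ^ 2 ≤ 1 := by nlinarith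
  have hPO : IsPseudoOrbit (delayCircuit K ε) 0 R T X :=
    IsPseudoOrbit.of_hasDerivAt hX fun t _ =>
      (kick_norm_le_one hX h0 hκsq t).trans (by exact_mod_cast hR)
  have hinit : ‖X 0 - delayInit‖ ≤ κ := by
    rw [h0]; exact norm_kickInit_sub_delayInit hκ0.le hκ1
  obtain ⟨tc, htc, hwin, -⟩ := h 0 κ X hPO hinit le_rfl (by simpa using hr)
  have hsK : 0 < Real.sqrt K := Real.sqrt_pos.2 hK0
  have hK10 : 1 ≤ K ^ 10 := one_le_pow₀ hK
  have hs₀pos : 0 < s₀ := by rw [hs₀]; linarith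
  have hsqK : Real.sqrt K ≤ K := by
    calc Real.sqrt K ≤ Real.sqrt (K ^ 2) := Real.sqrt_le_sqrt (by nlinarith)
      _ = K := Real.sqrt_sq hK0.le
  have hKK : K ≤ K ^ 10 := by
    calc K = K ^ 1 := (pow_one K).symm
      _ ≤ K ^ 10 := pow_le_pow_right₀ hK (by norm_num)
  have hΔ : 1 / (2 * K ^ 10) ≤ 1 / Real.sqrt K :=
    one_div_le_one_div_of_le hsK (by linarith)
  have hΔ2 : 1 / (2 * K ^ 10) ≤ 1 / 2 := one_div_le_one_div_of_le (by norm_num) (by linarith)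
  have h22 : Real.sqrt 2 ≤ 3 / 2 := by
    calc Real.sqrt 2 ≤ Real.sqrt ((3 / 2) ^ 2) := Real.sqrt_le_sqrt (by norm_num)
      _ = 3 / 2 := Real.sqrt_sq (by norm_num)
  have hpos : 0 ≤ (C + 2) / Real.sqrt K := div_nonneg (by linarith) hsK.le
  have hs2 : s₀ + 1 / (2 * K ^ 10) ≤ 2 := by rw [hs₀]; linarith
  have htc1 : Real.sqrt 2 - C / Real.sqrt K ≤ tc := by
    have := (abs_sub_le_iff.1 htc).2; linarith
  have hsplit : (C + 2) / Real.sqrt K = C / Real.sqrt K + 1 / Real.sqrt K + 1 / Real.sqrt K := by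
    ring
  have hwin' : s₀ + 1 / (2 * K ^ 10) ≤ tc - 1 / Real.sqrt K := by rw [hs₀]; linarith
  refine kick_core hX h0 hK hε hKε hκ0 hthr (γ := C / K ^ 10 + θ) (by linarith) hs₀pos hs2 le_rfl
    fun t ht => ?_
  obtain ⟨ha, hrest⟩ := hwin t ⟨ht.1, by linarith [ht.2]⟩ (ht.2.trans hwin')
  exact ⟨by have := (abs_sub_le_iff.1 ha).2; linarith, hrest 3 (by decide), hrest 4 (by decide)⟩

/-! ## B. Trivial channels: kicks beyond the window tolerance -/

/-- **Trivial channels.** A datum outside the sup-box of radius `CK⁻¹⁰` around (5.6) violates the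
first-window bound of Theorem 5.3 at `t = 0` (the window `[0, t_c - K^{-1/2}]` is non-empty once
`(C+1)/√K ≤ √2`): kicks of the carrier `a`, the rotor variable `d` or the output `ã` beyond `CK⁻¹⁰`
are excluded by the definition of the conclusion, whatever the dynamics.
[cite: Tao2016AveragedNS, Theorem 5.3] -/
theorem not_hasAbruptTransition_of_lt_norm_sub {C K : ℝ} {X : ℝ → Fin 5 → ℝ}
    (hCK : (C + 1) / Real.sqrt K ≤ Real.sqrt 2) (hfar : C / K ^ 10 < ‖X 0 - delayInit‖) :
    ¬ HasAbruptTransition C K X := by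
  rintro ⟨tc, htc, hwin, -⟩
  have h0 : (0 : ℝ) ∈ Icc 0 (tc - 1 / Real.sqrt K) := by
    refine ⟨le_rfl, ?_⟩
    have := (abs_sub_le_iff.1 htc).2
    have hsplit : (C + 1) / Real.sqrt K = C / Real.sqrt K + 1 / Real.sqrt K := by ring
    linarith
  obtain ⟨ha, hrest⟩ := hwin 0 h0
  have hγ0 : 0 ≤ C / K ^ 10 := (abs_nonneg _).trans ha
  have hle : ‖X 0 - delayInit‖ ≤ C / K ^ 10 := by
    refine (pi_norm_le_iff_of_nonneg hγ0).2 fun i => ?_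
    rw [Pi.sub_apply, Real.norm_eq_abs]
    fin_cases i
    · simpa [delayInit] using ha
    · simpa [delayInit] using hrest 1 (by decide)
    · simpa [delayInit] using hrest 2 (by decide)
    · simpa [delayInit] using hrest 3 (by decide)
    · simpa [delayInit] using hrest 4 (by decide)
  exact absurd hfar (not_lt.2 hle)

/-! ## C. The sandwich and the unconditional package -/

/-- Granted Theorem 5.3 for the reference trajectory, the Grönwall radius of `CircuitShadowing.lean`
is below the trigger threshold: `shadowRadius K ε R T θ < kickThreshold K ε (CK⁻¹⁰ + θ) s₀`.
[cite: Tao2016AveragedNS, Theorem 5.3] -/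
theorem shadowRadius_lt_kickThreshold {K ε T C θ : ℝ} {R : ℝ≥0} (hR : 1 ≤ R) (hK : 1 ≤ K)
    (hε : 0 < ε) (hKε : 13 * K ^ 15 * ε ≤ 1) (hC : 0 ≤ C) (hγ : 8 * (C / K ^ 10 + θ) ≤ 1)
    (hCK : (C + 2) / Real.sqrt K < Real.sqrt 2) (hT : 2 ≤ T)
    (hthr : kickThreshold K ε (C / K ^ 10 + θ) (Real.sqrt 2 - (C + 2) / Real.sqrt K) ≤ ε ^ 2)
    (hX : HasAbruptTransition C K (delaySolution K ε)) :
    shadowRadius K ε R T θ <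
      kickThreshold K ε (C / K ^ 10 + θ) (Real.sqrt 2 - (C + 2) / Real.sqrt K) := by
  by_contra hle
  exact not_firesOnBudget_of_kickThreshold_le hR hK hε hKε hC hγ hCK hT hthr (not_lt.1 hle)
    (firesOnBudget_shadowRadius hR hX)

/-- **Trigger fragility, unconditional form.** With the absolute constant `C` and the threshold
`K₀` of the tree's proof of Theorem 5.3 (`delaySolution_hasAbruptTransition`): for every
`K ≥ max K₀ 2` with `(C+2)/√K ≤ √2 - 1` there is `ε₁ > 0` such that for `0 < ε ≤ ε₁` with
`13K¹⁵ε ≤ 1`, every ball `R ≥ 1`, window `T ≥ 2` and efficiency loss `θ` with `8(CK⁻¹⁰ + θ) ≤ 1`,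
the gate (5.5) FIRES on the forcing budget `shadowRadius K ε R T θ` but on NO budget
`≥ kickThreshold K ε (CK⁻¹⁰ + θ) (√2 - (C+2)/√K)` — a number `≤ ε²`, of seed scale
`ε²e^{-K¹⁰ + O_C(K^{9.5})}`. [cite: Tao2016AveragedNS, Theorem 5.3] -/
theorem trigger_fragility :
    ∃ C : ℝ, 0 < C ∧ ∃ K₀ : ℝ, 0 < K₀ ∧ ∀ K : ℝ, K₀ ≤ K → 2 ≤ K →
      (C + 2) / Real.sqrt K ≤ Real.sqrt 2 - 1 → ∃ ε₁ : ℝ, 0 < ε₁ ∧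
        ∀ ε : ℝ, 0 < ε → ε ≤ ε₁ → 13 * K ^ 15 * ε ≤ 1 → ∀ (R : ℝ≥0), 1 ≤ R → ∀ T θ : ℝ,
          2 ≤ T → 8 * (C / K ^ 10 + θ) ≤ 1 →
            FiresOnBudget K ε R T C θ (shadowRadius K ε R T θ) ∧
            (∀ r, kickThreshold K ε (C / K ^ 10 + θ) (Real.sqrt 2 - (C + 2) / Real.sqrt K) ≤ r →
              ¬ FiresOnBudget K ε R T C θ r) ∧
            kickThreshold K ε (C / K ^ 10 + θ) (Real.sqrt 2 - (C + 2) / Real.sqrt K) ≤ ε ^ 2 := by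
  obtain ⟨C, hC, K₀, hK₀, hK⟩ := delaySolution_hasAbruptTransition
  refine ⟨C, hC, K₀, hK₀, fun K hKK hK2 hCK => ?_⟩
  obtain ⟨ε₁, hε₁, hε⟩ := hK K hKK
  refine ⟨ε₁, hε₁, fun ε hε0 hεε hKε R hR T θ hT hγ => ?_⟩
  have hX := hε ε hε0 hεε
  have hK1 : 1 ≤ K := by linarith
  have h21 : 1 < Real.sqrt 2 := by
    have := Real.sqrt_lt_sqrt (by norm_num : (0 : ℝ) ≤ 1) (by norm_num : (1 : ℝ) < 2)
    rwa [Real.sqrt_one] at this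
  have hCK' : (C + 2) / Real.sqrt K < Real.sqrt 2 := by linarith
  have hs1 : 1 ≤ Real.sqrt 2 - (C + 2) / Real.sqrt K := by linarith
  have hthr := kickThreshold_le_sq hK2 hε0 hKε (by linarith : C / K ^ 10 + θ ≤ 1 / 8) hs1
  exact ⟨firesOnBudget_shadowRadius hR hX,
    fun r hr => not_firesOnBudget_of_kickThreshold_le hR hK1 hε0 hKε hC.le hγ hCK' hT hthr hr,
    hthr⟩

end Literature.Analysis.FluidPDE.Tao2016AveragedNS
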